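import Mathlib
import Summits.NavierStokesRegularity.NavierStokesRegularity.Theorems.FilamentSkeletonRssStadiumPairAveraging

/-!
# Route `FilamentSkeletonRss` · child crux `TangentSkeletonNearStraightL` (stmt-NavierStokesRegularity-23320) · registered line
# `child_tangent_analytic_strip_L` (b0b56c52900dd90a), stub `stub_stripPropagation` — brick: PAIR AVERAGING WITH INTEGRABLE PROFILES, Re–Im FORM

`Theorems.StadiumPairAveraging` has the averaging principle with continuous profiles (Re–Im form) and with integrable profiles (norm and Re
forms).  The SLOPED chords of the quarter-width descent need the Re–Im form with INTEGRABLE (step / piecewise) profiles: the imaginary-part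
lemma `sum_sq_mean_abs_im_le_of_pairwise_integrable` and the chord transport `chord_sq_re_ge_of_pairwise_integrable`
(`Re(s²)(1 − ∫∫φ) − |Im(s²)|∫∫ψ ≤ Re Σᵢ (Fᵢ(z+s) − Fᵢ(z))²` for `Re(s²) ≥ 0`).
HONEST FRAMING: elementary bricks for a plan about a HYPOTHETICAL filament skeleton on the NEGATIVE side of a MODEL route; the stub
`stub_stripPropagation` is NOT closed by this file; nothing here bears on Navier–Stokes regularity or blow-up.  `--supports stmt-NavierStokesRegularity-23320`.
-/

set_option linter.dupNamespace false

noncomputable section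

namespace Summit.NavierStokesRegularity.NavierStokesRegularity.Theorems.StadiumPairAveragingIntegrable

open Set MeasureTheory
open scoped BigOperators
open Summit.NavierStokesRegularity.NavierStokesRegularity.Theorems.StadiumPairAveraging

/-- **Pair averaging, imaginary part, integrable profile.**  `a : [0,1] → ℂ³` continuous; `ψ` with `r′ ↦ ψ r r′` and `r ↦ ∫₀¹ ψ r r′`
interval-integrable and `|Im Σᵢ aᵢ(r)aᵢ(r′)| ≤ ψ(r,r′)` on the square: `|Im Σᵢ (∫₀¹ aᵢ)²| ≤ ∫₀¹∫₀¹ ψ` (step majorants allowed — the sloped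
chords of the quarter-width descent need this next to `sum_sq_mean_re_ge_of_pairwise_integrable`). [folklore] -/
theorem sum_sq_mean_abs_im_le_of_pairwise_integrable {a : ℝ → (Fin 3 → ℂ)} (ha : ContinuousOn a (uIcc (0:ℝ) 1))
    {ψ : ℝ → ℝ → ℝ} (hψi : ∀ r, IntervalIntegrable (ψ r) volume (0:ℝ) 1)
    (hΨi : IntervalIntegrable (fun r => ∫ r' in (0:ℝ)..1, ψ r r') volume (0:ℝ) 1)
    (hψ : ∀ r ∈ Icc (0:ℝ) 1, ∀ r' ∈ Icc (0:ℝ) 1, |(∑ i, a r i * a r' i).im| ≤ ψ r r') :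
    |(∑ i, (∫ r in (0:ℝ)..1, a r i) ^ 2).im| ≤ ∫ r in (0:ℝ)..1, ∫ r' in (0:ℝ)..1, ψ r r' := by
  have hai : ∀ i, ContinuousOn (fun r => a r i) (uIcc (0:ℝ) 1) := fun i =>
    (continuous_apply i).comp_continuousOn ha
  set W : Fin 3 → ℂ := fun i => ∫ r in (0:ℝ)..1, a r i with hW
  have hinner_eq : ∀ r, ∑ i, a r i * W i = ∫ r' in (0:ℝ)..1, ∑ i, a r i * a r' i := by
    intro r
    rw [intervalIntegral.integral_finsetSum fun i _ => ((hai i).intervalIntegrable.const_mul (a r i))]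
    refine Finset.sum_congr rfl fun i _ => ?_
    exact (intervalIntegral.integral_const_mul (a r i) _).symm
  have hinner_cont : ∀ r, ContinuousOn (fun r' => ∑ i, a r i * a r' i) (uIcc (0:ℝ) 1) := fun r =>
    continuousOn_finsetSum _ fun i _ => (continuousOn_const.mul (hai i))
  -- imaginary part of an interval integral against an INTEGRABLE bound
  have him_int : ∀ {f : ℝ → ℂ} {g : ℝ → ℝ}, ContinuousOn f (uIcc (0:ℝ) 1) → IntervalIntegrable g volume (0:ℝ) 1 →
      (∀ r ∈ Icc (0:ℝ) 1, |(f r).im| ≤ g r) → |(∫ r in (0:ℝ)..1, f r).im| ≤ ∫ r in (0:ℝ)..1, g r := by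
    intro f g hf hg h
    have him : (∫ r in (0:ℝ)..1, f r).im = ∫ r in (0:ℝ)..1, (f r).im := by
      have h1 := (Complex.imCLM.intervalIntegral_comp_comm (hf.intervalIntegrable (μ := volume)))
      simpa only [Complex.imCLM_apply] using h1.symm
    rw [him]
    have hb : ∀ᵐ r ∂volume, r ∈ Set.Ioc (0:ℝ) 1 → ‖(f r).im‖ ≤ g r :=
      Filter.Eventually.of_forall fun r hr => by simpa [Real.norm_eq_abs] using h r (Ioc_subset_Icc_self hr)
    have h2 := intervalIntegral.norm_integral_le_of_norm_le zero_le_one hb hg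
    simpa [Real.norm_eq_abs] using h2
  have hinner : ∀ r ∈ Icc (0:ℝ) 1, |(∑ i, a r i * W i).im| ≤ ∫ r' in (0:ℝ)..1, ψ r r' := by
    intro r hr
    rw [hinner_eq r]
    exact him_int (hinner_cont r) (hψi r) fun r' hr' => hψ r hr r' hr'
  have houter_eq : ∑ i, (W i) ^ 2 = ∫ r in (0:ℝ)..1, ∑ i, a r i * W i := by
    rw [intervalIntegral.integral_finsetSum fun i _ => ((hai i).intervalIntegrable.mul_const (W i))]
    refine Finset.sum_congr rfl fun i _ => ?_
    rw [sq]
    exact (intervalIntegral.integral_mul_const (W i) _).symm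
  have houter_cont : ContinuousOn (fun r => ∑ i, a r i * W i) (uIcc (0:ℝ) 1) :=
    continuousOn_finsetSum _ fun i _ => ((hai i).mul continuousOn_const)
  rw [houter_eq]
  exact him_int houter_cont hΨi hinner

/-- **Chord, pair-averaged real part with INTEGRABLE profiles.**  As `chord_sq_re_ge_of_pairwise`, with the continuity of `φ`, `ψ` replaced by
the interval-integrability facts (step / piecewise majorants allowed). [folklore] -/
theorem chord_sq_re_ge_of_pairwise_integrable {U : Set ℂ} (hU : IsOpen U) {F : ℂ → (Fin 3 → ℂ)} (hF : DifferentiableOn ℂ F U)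
    {z s : ℂ} (hseg : ∀ r ∈ Set.Icc (0:ℝ) 1, z + (r : ℂ) * s ∈ U)
    {φ ψ : ℝ → ℝ → ℝ}
    (hφi : ∀ r, IntervalIntegrable (φ r) volume (0:ℝ) 1)
    (hΦi : IntervalIntegrable (fun r => ∫ r' in (0:ℝ)..1, φ r r') volume (0:ℝ) 1)
    (hψi : ∀ r, IntervalIntegrable (ψ r) volume (0:ℝ) 1)
    (hΨi : IntervalIntegrable (fun r => ∫ r' in (0:ℝ)..1, ψ r r') volume (0:ℝ) 1)
    (hφ : ∀ r ∈ Icc (0:ℝ) 1, ∀ r' ∈ Icc (0:ℝ) 1,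
      1 - φ r r' ≤ (∑ i, deriv F (z + (r : ℂ) * s) i * deriv F (z + (r' : ℂ) * s) i).re)
    (hψ : ∀ r ∈ Icc (0:ℝ) 1, ∀ r' ∈ Icc (0:ℝ) 1,
      |(∑ i, deriv F (z + (r : ℂ) * s) i * deriv F (z + (r' : ℂ) * s) i).im| ≤ ψ r r')
    (hs : 0 ≤ (s ^ 2).re) :
    (s ^ 2).re * (1 - ∫ r in (0:ℝ)..1, ∫ r' in (0:ℝ)..1, φ r r') -
        |(s ^ 2).im| * (∫ r in (0:ℝ)..1, ∫ r' in (0:ℝ)..1, ψ r r') ≤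
      (∑ i, (F (z + s) i - F z i) ^ 2).re := by
  obtain ⟨ha, hFTC⟩ := chord_eq_mul_mean_deriv hU hF hseg
  have hre := sum_sq_mean_re_ge_of_pairwise_integrable ha hφi hΦi hφ
  have him := sum_sq_mean_abs_im_le_of_pairwise_integrable ha hψi hΨi hψ
  set P : ℂ := ∑ i, (∫ r in (0:ℝ)..1, deriv F (z + (r : ℂ) * s) i) ^ 2 with hPdef
  have hsum : (∑ i, (F (z + s) i - F z i) ^ 2) = s ^ 2 * P := by
    simp only [hPdef, Fin.sum_univ_three, hFTC]
    ring
  rw [hsum, Complex.mul_re]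
  have h1 : (s ^ 2).re * (1 - ∫ r in (0:ℝ)..1, ∫ r' in (0:ℝ)..1, φ r r') ≤ (s ^ 2).re * P.re :=
    mul_le_mul_of_nonneg_left hre hs
  have h2 : (s ^ 2).im * P.im ≤ |(s ^ 2).im| * ∫ r in (0:ℝ)..1, ∫ r' in (0:ℝ)..1, ψ r r' := by
    calc (s ^ 2).im * P.im ≤ |(s ^ 2).im * P.im| := le_abs_self _
      _ = |(s ^ 2).im| * |P.im| := abs_mul _ _
      _ ≤ |(s ^ 2).im| * ∫ r in (0:ℝ)..1, ∫ r' in (0:ℝ)..1, ψ r r' := mul_le_mul_of_nonneg_left him (abs_nonneg _)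
  linarith

end Summit.NavierStokesRegularity.NavierStokesRegularity.Theorems.StadiumPairAveragingIntegrable

end
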